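import Summits.BirchSwinnertonDyer.BirchSwinnertonDyer.Theorems.Rank2ObservatoryAnomHeightFreeBounds
import Summits.BirchSwinnertonDyer.BirchSwinnertonDyer.Theorems.Rank2ObservatoryPadicRow
import Literature.NumberTheory.EllipticCurves.Rank1Residual.Typed.PAdicCertificateGoodOrdinary
import Literature.NumberTheory.EllipticCurves.Rank1Residual.PrintShape
import Literature.NumberTheory.EllipticCurves.NonEisensteinPrimeOfSurjective
import HarnessLib

/-!
# BirchSwinnertonDyer — rank-2 `Ш[p^∞]` cell: the KATO-BOUND row frame `#Ш(E/ℚ)[p^∞] ≤ p^{b_p}`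
# (and `= 1` when `b_p = 0`) with the regulator valuation as a certified datum

HONEST FRAMING (cell `b2b-bsdr2sha`, run/shared/lean/b2b/bsd-rank2-sha/): per-pair certified
theorems «cited hypotheses ∧ certified computation ⇒ `Ш(E/ℚ)[p^∞]` finite of order `p^k`» for
rank-2 curves at good ordinary primes; NO claim on BSD in rank `≥ 2`, no class-level theorem, every
published input is a NAMED HYPOTHESIS of the tree (nothing is asserted or minted here).

Frame «kato-bound» of the cell's census (PLAN.md ruling P-3; verdict words V-BOUND b / «Ш[p] = 0»
of referee/REFEREE.md R1): the row does NOT satisfy (or does not need) Skinner–Urban's (ram)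
hypothesis, but `ρ̄_{E,p}` is surjective, so Kato's INTEGRAL divisibility (Astérisque 295 (2004),
Thm. 17.4 (3): `L_p ∈ char_Λ X(E/ℚ_∞)` under (12.5.2), implied at `p ≥ 5` by mod-`p` surjectivity via
Serre) and Perrin-Riou–Schneider (Balakrishnan–Müller–Stein 2016 Thm. 1.7, `p > 2`) give the
ONE-SIDED bound of Stein–Wuthrich, Math. Comp. 82 (2013), Alg. 11.1 step 4 / Prop. 11.2:

  `ord_p #Ш(E/ℚ)[p^∞] ≤ b_p := ord_p [T^r]L_p + r − 2·ord_p #Ẽ(𝔽_p) − ord_p ∏c_ℓ − ord_p Reg_p(E)`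

(no torsion term: `ρ̄` surjective ⇒ `E[p]` irreducible ⇒ `p ∤ #E(ℚ)_tors`), and `b_p = 0` forces
`Ш(E/ℚ)[p^∞] = 0` EXACTLY. The inequality itself is the rank-`≤ 1` cell's tree theorem
`padicBSD_inequality_of_kato_of_surjective_pow` (`Rank1Residual/Typed/PAdicCertificateGoodOrdinary.lean`);
this file only (i) derives its input `ord_{T=0} L_p = rank` from the census certificates `r ≤ rank`,
`[T^r] L_p ≠ 0` by the observatory's Kato squeeze (`Rank2Observatory.rank_eq_and_order_eq_of_certificate`),
(ii) discharges `ρ_{E,p^∞}` surjective from the census bit `Surj W p` (Serre, `p ≥ 5`; Wuthrich 2014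
Lemma 20 at `p = 3`, named fact), and (iii) unpacks the valuations into the census integers with the
two certified data `a = ord_p [T^r] L_p`, `b = ord_p Reg_p(E, Dh)` (THE canonical height). The
two-sided frame «su-exact» (`= p^{b_p}`, Skinner–Urban) is `Rank2ShaOrderRow.lean`.

* `valuation_epsSq_mul_tam_mul_reg`, `valuation_coeff_mul_logPow_mul_torsSq` — the two valuation
  expansions (`ord_p(1 − α⁻¹) = ord_p #Ẽ(𝔽_p)`, `ord_p log_p(1+p) = 1`).
* `card_shaPrimary_le_of_kato_certificate` — THE KATO ROW at `p ≥ 5`: named facts `hS`, `hK`; per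
  curve `IsOrdinaryAt W p`, `Surj W p`, the newform `hf`; certified `hlow`, `hLp`, `a`, `b` ⇒ `rank = r`,
  `Ш(E/ℚ)[p^∞]` finite, `Reg_p ≠ 0`, `ord_p #Ш(E/ℚ)[p^∞] ≤ a + r − 2·ord_p #Ẽ(𝔽_p) − ord_p ∏c_ℓ − b`.
* `card_shaPrimary_eq_one_of_kato_certificate` — `… ≤ 0` ⇒ `#Ш(E/ℚ)[p^∞] = 1` (verdict «Ш[p] = 0»).
* `card_shaPrimary_le_of_kato_certificate_three` / `…_eq_one_…_three` — `p = 3` with Wuthrich's Lemma 20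
  (`hW20`) and THE canonical `3`-adic height as a parameter.

References: K. Kato, Astérisque 295 (2004), Thm. 17.4 (3) (p. 273), (12.5.2) (p. 222)
[Kato2004Asterisque]; J. Balakrishnan, J. S. Müller, W. Stein, Math. Comp. 85 (2016), Thm. 1.7
[BalakrishnanMullerStein2015]; W. Stein, C. Wuthrich, Math. Comp. 82 (2013), §§3–4, Alg. 11.1,
Prop. 11.2 [SteinWuthrich2013]; J.-P. Serre, Invent. Math. 15 (1972), IV §3.4 [Serre1972];
C. Wuthrich, Doc. Math. 19 (2014), Lemma 20 [Wuthrich2014]; B. Mazur, Publ. IHÉS 47 (1977), p. 157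
[Mazur1977].
-/

set_option autoImplicit false

-- single-conjunct summit: `Summit.BirchSwinnertonDyer.BirchSwinnertonDyer.…` repeats the name by design
set_option linter.dupNamespace false

noncomputable section

open scoped Classical MatrixGroups ModularForm

open CongruenceSubgroup WeierstrassCurve Literature.NumberTheory.EllipticCurves
  Literature.NumberTheory.EllipticCurves.ModularForms
  Literature.NumberTheory.EllipticCurves.Rank1Residual
  Literature.NumberTheory.EllipticCurves.Rank1Residual.Typed
  Literature.NumberTheory.EllipticCurves.Wuthrich2014
  Summit.BirchSwinnertonDyer.BirchSwinnertonDyer.Rank2Observatory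

namespace Summit.BirchSwinnertonDyer.BirchSwinnertonDyer.Rank2Sha

/-! ## §1. The two valuation expansions -/

/-- **`ord_p((1 − α⁻¹)² · ∏c_ℓ · R) = 2·ord_p #Ẽ(𝔽_p) + ord_p ∏c_ℓ + ord_p R`** for `R ≠ 0` at a good
ordinary `p` (`1 − α⁻¹ = u · #Ẽ(𝔽_p)`, `u ∈ ℤ_pˣ`, tree `exists_unit_one_sub_unitRoot_inv`; BMS's remark
`ord_p ε_p = 2 ord_p N_p`). [cite: BalakrishnanMullerStein2015, Thm. 1.7 (remark following)] -/
theorem valuation_epsSq_mul_tam_mul_reg (W : WeierstrassCurve ℚ) [W.IsElliptic] [W.IsGloballyMinimal]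
    (p : ℕ) [Fact p.Prime] (hordin : IsOrdinaryAt W p) {R : ℚ_[p]} (hR : R ≠ 0) :
    ((1 - (unitRoot W p : ℚ_[p])⁻¹) ^ 2 * (W.tamagawaProduct : ℚ_[p]) * R).valuation =
      2 * (padicValNat p (W.reductionPointCount p) : ℤ) + padicValNat p W.tamagawaProduct +
        R.valuation := by
  obtain ⟨u₂, hu₂⟩ := exists_unit_one_sub_unitRoot_inv p W hordin
  have hN0 : (W.reductionPointCount p : ℚ_[p]) ≠ 0 := by
    exact_mod_cast (W.reductionPointCount_pos p).ne'
  have hε0 : (1 - (unitRoot W p : ℚ_[p])⁻¹) ≠ 0 := by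
    rw [hu₂]; exact mul_ne_zero (coe_units_ne_zero p u₂) hN0
  have hc0 : (W.tamagawaProduct : ℚ_[p]) ≠ 0 := by
    exact_mod_cast (W.tamagawaProduct_pos_holds : 0 < W.tamagawaProduct).ne'
  rw [Padic.valuation_mul (mul_ne_zero (pow_ne_zero 2 hε0) hc0) hR,
    Padic.valuation_mul (pow_ne_zero 2 hε0) hc0, Padic.valuation_pow, hu₂,
    Padic.valuation_mul (coe_units_ne_zero p u₂) hN0, valuation_coe_units_eq_zero, zero_add,
    Padic.valuation_natCast, Padic.valuation_natCast]
  push_cast; ring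

/-- **`ord_p(c · log_p(γ_cyc)^r · #E(ℚ)_tors²) = ord_p c + r + 2·ord_p #E(ℚ)_tors`** for `c ≠ 0` and odd
`p` (`log_p(1+p) = p · unit`, tree `exists_unit_padicLog_cyclotomicGenerator`, Iwasawa 1972 §4.4).
[cite: Iwasawa1972PadicL, §4.4] -/
theorem valuation_coeff_mul_logPow_mul_torsSq (W : WeierstrassCurve ℚ) [W.IsElliptic] (p : ℕ)
    [Fact p.Prime] (hp2 : p ≠ 2) {c : ℚ_[p]} (hc : c ≠ 0) (r : ℕ) :
    (c * (padicLog p (cyclotomicGenerator p) ^ r * (W.torsionOrder : ℚ_[p]) ^ 2)).valuation =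
      c.valuation + r + 2 * (padicValNat p W.torsionOrder : ℤ) := by
  obtain ⟨u₃, hu₃⟩ := exists_unit_padicLog_cyclotomicGenerator p hp2
  have hp0 : (p : ℚ_[p]) ≠ 0 := Nat.cast_ne_zero.mpr (Fact.out : p.Prime).ne_zero
  have hlog0 : padicLog p (cyclotomicGenerator p : ℚ_[p]) ≠ 0 := by
    rw [hu₃]; exact mul_ne_zero hp0 (coe_units_ne_zero p u₃)
  have ht0 : (W.torsionOrder : ℚ_[p]) ≠ 0 := by
    exact_mod_cast (W.torsionOrder_pos_holds : 0 < W.torsionOrder).ne'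
  rw [Padic.valuation_mul hc (mul_ne_zero (pow_ne_zero _ hlog0) (pow_ne_zero 2 ht0)),
    Padic.valuation_mul (pow_ne_zero _ hlog0) (pow_ne_zero 2 ht0), Padic.valuation_pow,
    Padic.valuation_pow, hu₃, Padic.valuation_mul hp0 (coe_units_ne_zero p u₃),
    valuation_coe_units_eq_zero, add_zero, Padic.valuation_p, Padic.valuation_natCast]
  push_cast; ring

/-! ## §2. The Kato-bound row at `p ≥ 5` -/

/-- **THE KATO ROW: `ord_p #Ш(E/ℚ)[p^∞] ≤ b_p` at a certified rank-`r` cell `(E, p)`, `p ≥ 5`, `ρ̄_{E,p}`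
surjective.** HYPOTHESES, cited: `hK` — Kato 2004 Thm. 17.4 for every cyclotomic datum (tree named fact
`kato_divisibility`; clause (3), integral, under `ρ_{E,p^n}` surjective for all `n`, which at `p ≥ 5`
follows from `Surj W p` by Serre IV §3.4, tree theorem `serre_hasSurjectiveModNGaloisRep_pow_holds`);
`hS` — Perrin-Riou–Schneider, BMS 2016 Thm. 1.7 (`Schneider1985_order_charGenerator_odd`). Per curve:
`p ≥ 5` good ordinary (`hordin`), `ρ̄_{E,p}` surjective (`hsurj`, the census's Serre-witness bit), the
newform `hf`, THE canonical height `Dh` (`hDh`). Certified computation: `r ≤ rank_ℤ E(ℚ)` (`hlow`),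
`[T^r] L_p ≠ 0` with `ord_p [T^r] L_p = a` (`hLp`, `hcoeff`), `ord_p Reg_p(E, Dh) = b` (`hreg`).
CONCLUSION: `rank_ℤ E(ℚ) = r`, `Ш(E/ℚ)[p^∞]` finite, `Reg_p ≠ 0`, and
`ord_p #Ш(E/ℚ)[p^∞] ≤ a + r − 2·ord_p #Ẽ(𝔽_p) − ord_p ∏c_ℓ − b` (= Stein–Wuthrich's bound with
`ord_p ε_p = 2 ord_p N_p`, `ord_p Reg_γ = b − r`; torsion term absent because `ρ̄` surjective ⇒ `E[p]`
irreducible ⇒ `p ∤ #E(ℚ)_tors`, tree `padicValNat_torsionOrder_eq_zero_of_irreducible`). Per pair; NOT a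
class theorem. [cite: Kato2004Asterisque, Thm. 17.4 (3) (p. 273)] [cite: BalakrishnanMullerStein2015, Thm. 1.7]
[cite: SteinWuthrich2013, Alg. 11.1 and Prop. 11.2] [cite: Serre1972, IV §3.4] -/
theorem card_shaPrimary_le_of_kato_certificate
    (hS : Schneider1985_order_charGenerator_odd)
    (W : WeierstrassCurve ℚ) [W.IsElliptic] [W.IsGloballyMinimal] (p : ℕ) [Fact p.Prime]
    {N : ℕ} [NeZero N] (f : CuspForm (Gamma0 N) 2)
    (hK : ∀ (κ : ZpExtension ℚ p) (γ : Field.absoluteGaloisGroup ℚ),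
      kato_divisibility W p (κ := κ) (γ := γ) (f := f))
    (h5 : 5 ≤ p) (hordin : IsOrdinaryAt W p) (hsurj : W.HasSurjectiveModNGaloisRep p)
    (hf : IsNewformOf W f) {r : ℕ} (hlow : r ≤ W.mordellWeilRank)
    (hLp : PowerSeries.coeff r (padicLFunction f (unitRoot W p : ℚ_[p])) ≠ 0)
    (Dh : PAdicHeightData W p) (hDh : Dh.IsCanonical) {a b : ℤ}
    (hcoeff : (PowerSeries.coeff r (padicLFunction f (unitRoot W p : ℚ_[p]))).valuation = a)
    (hreg : (padicRegulator Dh).valuation = b) :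
    W.mordellWeilRank = r ∧ Finite (AddCommGroup.primaryComponent W.sha p) ∧
      SchneiderConjecture Dh ∧
      (padicValNat p (Nat.card (AddCommGroup.primaryComponent W.sha p)) : ℤ) ≤
        a + r - 2 * padicValNat p (W.reductionPointCount p) - padicValNat p W.tamagawaProduct - b := by
  have hp2 : p ≠ 2 := by omega
  haveI : NeZero (p : ℚ) := ⟨Nat.cast_ne_zero.mpr (Fact.out : p.Prime).ne_zero⟩
  have hsurjpow : ∀ n : ℕ, W.HasSurjectiveModNGaloisRep (p ^ n : ℕ) :=
    serre_hasSurjectiveModNGaloisRep_pow_holds W p h5 hsurj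
  have hirr : W.HasIrreducibleModPGaloisRep p :=
    hasIrreducibleModPGaloisRep_of_hasSurjectiveModNGaloisRep W p hsurj
  obtain ⟨hr, hord⟩ := rank_eq_and_order_eq_of_certificate W p hK hp2 hordin hf hlow hLp
  have hord' : (padicLFunction f (unitRoot W p : ℚ_[p])).order = W.mordellWeilRank := by
    rw [hr]; exact hord
  obtain ⟨hfin, hSch, hle⟩ := padicBSD_inequality_of_kato_of_surjective_pow hS W p f hK hp2 hordin.1
    hordin.2 hsurjpow hf Dh hDh hord'
  refine ⟨hr, hfin, hSch, ?_⟩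
  have hcoeff0 : PowerSeries.coeff W.mordellWeilRank (padicLFunction f (unitRoot W p : ℚ_[p])) ≠ 0 := by
    rw [hr]; exact hLp
  rw [valuation_epsSq_mul_tam_mul_reg W p hordin hSch,
    valuation_coeff_mul_logPow_mul_torsSq W p hp2 hcoeff0, hr, hcoeff, hreg,
    padicValNat_torsionOrder_eq_zero_of_irreducible W p hirr, Nat.cast_zero, mul_zero, add_zero] at hle
  linarith

/-- **`b_p = 0` ⇒ `Ш(E/ℚ)[p^∞] = 0` EXACTLY** (the verdict «Ш(E/ℚ)[p] = 0» of the Kato frame): with the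
inputs of `card_shaPrimary_le_of_kato_certificate` and `a + r − 2·ord_p #Ẽ(𝔽_p) − ord_p ∏c_ℓ − b ≤ 0`,
`#Ш(E/ℚ)[p^∞] = 1` (a finite `p`-primary group of order prime to `p` is trivial,
`natCard_primaryComponent_eq_one`). This is Stein–Wuthrich's Thm. 1.1 mechanism, row by row.
[cite: SteinWuthrich2013, Thm. 1.1 and Alg. 11.1] [cite: Kato2004Asterisque, Thm. 17.4 (3) (p. 273)]
[cite: BalakrishnanMullerStein2015, Thm. 1.7] -/
theorem card_shaPrimary_eq_one_of_kato_certificate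
    (hS : Schneider1985_order_charGenerator_odd)
    (W : WeierstrassCurve ℚ) [W.IsElliptic] [W.IsGloballyMinimal] (p : ℕ) [Fact p.Prime]
    {N : ℕ} [NeZero N] (f : CuspForm (Gamma0 N) 2)
    (hK : ∀ (κ : ZpExtension ℚ p) (γ : Field.absoluteGaloisGroup ℚ),
      kato_divisibility W p (κ := κ) (γ := γ) (f := f))
    (h5 : 5 ≤ p) (hordin : IsOrdinaryAt W p) (hsurj : W.HasSurjectiveModNGaloisRep p)
    (hf : IsNewformOf W f) {r : ℕ} (hlow : r ≤ W.mordellWeilRank)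
    (hLp : PowerSeries.coeff r (padicLFunction f (unitRoot W p : ℚ_[p])) ≠ 0)
    (Dh : PAdicHeightData W p) (hDh : Dh.IsCanonical) {a b : ℤ}
    (hcoeff : (PowerSeries.coeff r (padicLFunction f (unitRoot W p : ℚ_[p]))).valuation = a)
    (hreg : (padicRegulator Dh).valuation = b)
    (hbp : a + r - 2 * padicValNat p (W.reductionPointCount p) - padicValNat p W.tamagawaProduct - b ≤ 0) :
    W.mordellWeilRank = r ∧ Finite (AddCommGroup.primaryComponent W.sha p) ∧
      SchneiderConjecture Dh ∧ Nat.card (AddCommGroup.primaryComponent W.sha p) = 1 := by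
  obtain ⟨hr, hfin, hSch, hle⟩ := card_shaPrimary_le_of_kato_certificate hS W p f hK h5 hordin hsurj hf
    hlow hLp Dh hDh hcoeff hreg
  haveI := hfin
  have hv0 : padicValNat p (Nat.card (AddCommGroup.primaryComponent W.sha p)) = 0 := by
    have : (padicValNat p (Nat.card (AddCommGroup.primaryComponent W.sha p)) : ℤ) ≤ 0 := hle.trans hbp
    omega
  have hndvd : ¬ p ∣ Nat.card (AddCommGroup.primaryComponent W.sha p) := by
    rcases padicValNat.eq_zero_iff.mp hv0 with h1 | h0 | hnd
    · exact absurd h1 (Fact.out : p.Prime).one_lt.ne'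
    · exact absurd h0 Nat.card_pos.ne'
    · exact hnd
  exact ⟨hr, hfin, hSch, natCard_primaryComponent_eq_one p hndvd⟩

/-! ## §3. The Kato-bound row at `p = 3` (Wuthrich's Lemma 20) -/

/-- **THE KATO ROW at `p = 3`: `ord_3 #Ш(E/ℚ)[3^∞] ≤ b_3`.** As `card_shaPrimary_le_of_kato_certificate`,
except: `3`-adic surjectivity (Kato's (12.5.2)) does NOT follow from mod-`3` surjectivity in general
(Elkies) but DOES at a prime `3` of good reduction — Wuthrich, Doc. Math. 19 (2014), Lemma 20, named
fact `hW20` —; THE canonical `3`-adic height `Dh` is a parameter; the rank/order squeeze is Kato's bound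
at an odd prime (`rank_eq_and_order_eq_of_certificate` needs only `p ≠ 2`). Per pair; NOT a class theorem.
[cite: Kato2004Asterisque, Thm. 17.4 (3) (p. 273) and (12.5.2) (p. 222)] [cite: Wuthrich2014, Lemma 20 (p. 399)]
[cite: BalakrishnanMullerStein2015, Thm. 1.7] [cite: SteinWuthrich2013, Alg. 11.1 and Prop. 11.2] -/
theorem card_shaPrimary_le_of_kato_certificate_three
    (hS : Schneider1985_order_charGenerator_odd) (hW20 : lemma20_surjective_threeAdic_of_semistable)
    (W : WeierstrassCurve ℚ) [W.IsElliptic] [W.IsGloballyMinimal]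
    {N : ℕ} [NeZero N] (f : CuspForm (Gamma0 N) 2)
    (hK : ∀ (κ : ZpExtension ℚ 3) (γ : Field.absoluteGaloisGroup ℚ),
      kato_divisibility W 3 (κ := κ) (γ := γ) (f := f))
    (hordin : IsOrdinaryAt W 3) (hsurj : W.HasSurjectiveModNGaloisRep 3)
    (hf : IsNewformOf W f) {r : ℕ} (hlow : r ≤ W.mordellWeilRank)
    (hLp : PowerSeries.coeff r (padicLFunction f (unitRoot W 3 : ℚ_[3])) ≠ 0)
    (Dh : PAdicHeightData W 3) (hDh : Dh.IsCanonical) {a b : ℤ}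
    (hcoeff : (PowerSeries.coeff r (padicLFunction f (unitRoot W 3 : ℚ_[3]))).valuation = a)
    (hreg : (padicRegulator Dh).valuation = b) :
    W.mordellWeilRank = r ∧ Finite (AddCommGroup.primaryComponent W.sha 3) ∧
      SchneiderConjecture Dh ∧
      (padicValNat 3 (Nat.card (AddCommGroup.primaryComponent W.sha 3)) : ℤ) ≤
        a + r - 2 * padicValNat 3 (W.reductionPointCount 3) - padicValNat 3 W.tamagawaProduct - b := by
  haveI : NeZero ((3 : ℕ) : ℚ) := ⟨by norm_num⟩
  have hsurjpow : ∀ n : ℕ, W.HasSurjectiveModNGaloisRep (3 ^ n : ℕ) :=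
    hW20 W (Or.inl hordin.1) hsurj
  have hirr : W.HasIrreducibleModPGaloisRep 3 :=
    hasIrreducibleModPGaloisRep_of_hasSurjectiveModNGaloisRep W 3 hsurj
  obtain ⟨hr, hord⟩ := rank_eq_and_order_eq_of_certificate W 3 hK (by decide) hordin hf hlow hLp
  have hord' : (padicLFunction f (unitRoot W 3 : ℚ_[3])).order = W.mordellWeilRank := by
    rw [hr]; exact hord
  obtain ⟨hfin, hSch, hle⟩ := padicBSD_inequality_of_kato_of_surjective_pow hS W 3 f hK (by decide)
    hordin.1 hordin.2 hsurjpow hf Dh hDh hord'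
  refine ⟨hr, hfin, hSch, ?_⟩
  have hcoeff0 : PowerSeries.coeff W.mordellWeilRank (padicLFunction f (unitRoot W 3 : ℚ_[3])) ≠ 0 := by
    rw [hr]; exact hLp
  rw [valuation_epsSq_mul_tam_mul_reg W 3 hordin hSch,
    valuation_coeff_mul_logPow_mul_torsSq W 3 (by decide) hcoeff0, hr, hcoeff, hreg,
    padicValNat_torsionOrder_eq_zero_of_irreducible W 3 hirr, Nat.cast_zero, mul_zero, add_zero] at hle
  linarith

/-- **`b_3 = 0` ⇒ `Ш(E/ℚ)[3^∞] = 0`** at a certified cell `(E, 3)` (Kato frame with Wuthrich's Lemma 20).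
[cite: Wuthrich2014, Lemma 20 (p. 399)] [cite: Kato2004Asterisque, Thm. 17.4 (3) (p. 273)]
[cite: SteinWuthrich2013, Alg. 11.1] -/
theorem card_shaPrimary_eq_one_of_kato_certificate_three
    (hS : Schneider1985_order_charGenerator_odd) (hW20 : lemma20_surjective_threeAdic_of_semistable)
    (W : WeierstrassCurve ℚ) [W.IsElliptic] [W.IsGloballyMinimal]
    {N : ℕ} [NeZero N] (f : CuspForm (Gamma0 N) 2)
    (hK : ∀ (κ : ZpExtension ℚ 3) (γ : Field.absoluteGaloisGroup ℚ),
      kato_divisibility W 3 (κ := κ) (γ := γ) (f := f))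
    (hordin : IsOrdinaryAt W 3) (hsurj : W.HasSurjectiveModNGaloisRep 3)
    (hf : IsNewformOf W f) {r : ℕ} (hlow : r ≤ W.mordellWeilRank)
    (hLp : PowerSeries.coeff r (padicLFunction f (unitRoot W 3 : ℚ_[3])) ≠ 0)
    (Dh : PAdicHeightData W 3) (hDh : Dh.IsCanonical) {a b : ℤ}
    (hcoeff : (PowerSeries.coeff r (padicLFunction f (unitRoot W 3 : ℚ_[3]))).valuation = a)
    (hreg : (padicRegulator Dh).valuation = b)
    (hbp : a + r - 2 * padicValNat 3 (W.reductionPointCount 3) - padicValNat 3 W.tamagawaProduct - b ≤ 0) :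
    W.mordellWeilRank = r ∧ Finite (AddCommGroup.primaryComponent W.sha 3) ∧
      SchneiderConjecture Dh ∧ Nat.card (AddCommGroup.primaryComponent W.sha 3) = 1 := by
  obtain ⟨hr, hfin, hSch, hle⟩ := card_shaPrimary_le_of_kato_certificate_three hS hW20 W f hK hordin
    hsurj hf hlow hLp Dh hDh hcoeff hreg
  haveI := hfin
  have hv0 : padicValNat 3 (Nat.card (AddCommGroup.primaryComponent W.sha 3)) = 0 := by
    have : (padicValNat 3 (Nat.card (AddCommGroup.primaryComponent W.sha 3)) : ℤ) ≤ 0 := hle.trans hbp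
    omega
  have hndvd : ¬ 3 ∣ Nat.card (AddCommGroup.primaryComponent W.sha 3) := by
    rcases padicValNat.eq_zero_iff.mp hv0 with h1 | h0 | hnd
    · exact absurd h1 (by decide)
    · exact absurd h0 Nat.card_pos.ne'
    · exact hnd
  exact ⟨hr, hfin, hSch, natCard_primaryComponent_eq_one 3 hndvd⟩

end Summit.BirchSwinnertonDyer.BirchSwinnertonDyer.Rank2Sha

end
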